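import Mathlib
import Summits.CriticalPhenomena.PercolationContinuityZ3.Theorems.PercNearOneGluingAdditiveGluingSigmaRecursion
import Summits.CriticalPhenomena.PercolationContinuityZ3.Theorems.PercNearOneGluingAdditiveGluingSigmaLaw
import Summits.CriticalPhenomena.PercolationContinuityZ3.Theorems.PercNearOneGluingAdditiveGluingSigmaGeometry
import Summits.CriticalPhenomena.PercolationContinuityZ3.Theorems.PercNearOneGluingAdditiveGluingGluingLemma5
import Summits.CriticalPhenomena.PercolationContinuityZ3.Theorems.PercNearOneGluingAdditiveGluingGoodStep24Engine
import HarnessLib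

/-!
# `NoHeavyLowerTail` (stmt-CriticalPhenomena-4575) — FRACTIONAL witnesses: additive gluing with constant
# = the fractional cover number of the lower sets, any observer depth; the RANK corollary is k-uniform

Support file (hull-port / coupling seat `prim-hp-1` gen 5; `--supports stmt-CriticalPhenomena-4575`).
No definitions, no named facts, no sorries.  Supersedes the integral version `…FewWitnessGluing`.
`μ = prodBernoulli w` on `Fin n`, relays `A`, `b ∈ A`, a Steiner region `R ∋ o` disjoint from `A` and closed
under positive pairs towards non-relays, WEIGHTS `Λ ≥ 0` on `A` such that for every `o ∈ U ⊆ R` and every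
relay `v` receiving a positive pair from `U` the LOWER SET `{a ∈ A : P_{G−U}(a ↔ b) ≤ P_{G−U}(v ↔ b)}` has
`Λ`-mass `≥ 1` (Kozma–Nitzan's designated relay = point mass at the minimiser, `R = {o}`).
* `sigmaRec_engine_frac` — the σ-recursion engine (arXiv:2401.12397, Thms 4–5; tree file
  `…AdditiveGluingSigmaRecursion`) with a fractional comparison (KN Lemma 5 for every relay of the lower set).
* `fracWitness_blockGluing` / `nearOneGluing_of_fracWitnesses` —
  **`P(o ↔ A) − P(o ↔ b) ≤ Σ_{a∈A} Λ a · P(a ↮ b)`** at any depth.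
* `nearOneGluing_of_rank` — if every lower set has `≥ r` elements (the region never grabs only relays among
  the `r` weakest of the region-deleted graph): `P(o ↔ A) − P(o ↔ b) ≤ (1/r) Σ_{a∈A} P(a ↮ b) ≤ (|A|/r)·t`.
Memo HULLPORT-COUPLING.md §43: the loss between the exact Steiner-pocket decomposition and additive gluing
is witness switching; its price is the fractional cover number of the lower-set family.
-/

namespace Summit.CriticalPhenomena.PercolationContinuityZ3.Theorems

open MeasureTheory Set
open Literature.Probability.LatticeModels (prodBernoulli)
open Literature.Probability.Percolation (BondConfig openConn openGraph)

noncomputable section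
open Classical

variable {n : ℕ}

/-! ### The engine with a finite witness set -/

/-- **σ-recursion engine with fractional witnesses** (ingredients as in `sigmaRec_engine`; per relay layer the
relays beaten by the glued layer carry `Λ`-mass `≥ 1`, per Steiner layer the deficit is `≤ Σ_a Λ a μ'(a ↮ b)`):
`μ_p(O ↔ A) − μ_p(O ↔ b) ≤ Σ_{a∈A} Λ a (1 − μ_p(a ↔ b))`. [cite: KozmaNitzan2024, proofs of Thms 4–5 (pp. 13–14)] -/
theorem sigmaRec_engine_frac (w p : Sym2 (Fin n) → unitInterval)
    (q : Finset (Fin n) → Sym2 (Fin n) → unitInterval) (O A : Finset (Fin n)) (Λ : Fin n → ℝ)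
    (b : Fin n)
    (Ψ : Finset (Fin n) → BondConfig (Fin n) → BondConfig (Fin n)) (K : Set (BondConfig (Fin n)))
    (hΛ : ∀ a ∈ A, 0 ≤ Λ a)
    (hK : ∀ ω, ω ∉ K → ∃ e, p e = 1 ∧ e ∉ ω)
    (hpO : ∀ o x : Fin n, x ∉ O → p s(o, x) = w s(o, x))
    (hgeoA : ∀ (S : Finset (Fin n)) (ω : BondConfig (Fin n)),
      (∀ x : Fin n, x ∈ S ↔ (x ∉ O ∧ ∃ o ∈ O, s(o, x) ∈ ω)) → ω ∈ K →
      (ω ∈ (⋃ o ∈ O, ⋃ x ∈ A, openConn o x) ↔ Ψ S ω ∈ (⋃ s ∈ S, ⋃ x ∈ A, openConn s x)))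
    (hgeob : ∀ (S : Finset (Fin n)) (ω : BondConfig (Fin n)),
      (∀ x : Fin n, x ∈ S ↔ (x ∉ O ∧ ∃ o ∈ O, s(o, x) ∈ ω)) → ω ∈ K →
      (ω ∈ (⋃ o ∈ O, openConn o b) ↔ Ψ S ω ∈ (⋃ s ∈ S, openConn s b)))
    (hgeoD : ∀ a ∈ A, ∀ (S : Finset (Fin n)) (ω : BondConfig (Fin n)),
      (∀ x : Fin n, x ∈ S ↔ (x ∉ O ∧ ∃ o ∈ O, s(o, x) ∈ ω)) → ω ∈ K →
      (ω ∈ openConn a b ↔ Ψ S ω ∈ openConn a b))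
    (hlaw : ∀ (S : Finset (Fin n)) (E : Set (BondConfig (Fin n))),
      (prodBernoulli p).real
          ({ω | ∀ x : Fin n, x ∈ S ↔ (x ∉ O ∧ ∃ o ∈ O, s(o, x) ∈ ω)} ∩ {ω | Ψ S ω ∈ E}) =
        (prodBernoulli p).real {ω | ∀ x : Fin n, x ∈ S ↔ (x ∉ O ∧ ∃ o ∈ O, s(o, x) ∈ ω)} *
          (prodBernoulli (q S)).real E)
    (hL5 : ∀ S : Finset (Fin n), (∀ x ∈ S, x ∉ O ∧ ∃ o ∈ O, w s(o, x) ≠ 0) →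
      (S ∩ A).Nonempty → b ∉ S →
      1 ≤ ∑ a ∈ A.filter (fun a => (prodBernoulli (q S)).real (openConn a b) ≤
        (prodBernoulli (q S)).real (⋃ s ∈ S, openConn s b)), Λ a)
    (hdef : ∀ S : Finset (Fin n), (∀ x ∈ S, x ∉ O ∧ ∃ o ∈ O, w s(o, x) ≠ 0) →
      S.Nonempty → Disjoint S A → b ∉ S →
      (prodBernoulli (q S)).real (⋃ s ∈ S, ⋃ x ∈ A, openConn s x) -
          (prodBernoulli (q S)).real (⋃ s ∈ S, openConn s b) ≤
        ∑ a ∈ A, Λ a * (1 - (prodBernoulli (q S)).real (openConn a b))) :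
    (prodBernoulli p).real (⋃ o ∈ O, ⋃ x ∈ A, openConn o x) -
        (prodBernoulli p).real (⋃ o ∈ O, openConn o b) ≤
      ∑ a ∈ A, Λ a * (1 - (prodBernoulli p).real (openConn a b)) := by
  have hKc : prodBernoulli p Kᶜ = 0 := sigmaRec_conull p K hK
  set c : Finset (Fin n) → ℝ := fun S =>
    (prodBernoulli p).real {ω | ∀ x : Fin n, x ∈ S ↔ (x ∉ O ∧ ∃ o ∈ O, s(o, x) ∈ ω)} with hc
  have hfac : ∀ (S : Finset (Fin n)) (F F' : Set (BondConfig (Fin n))),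
      (∀ ω : BondConfig (Fin n), (∀ x : Fin n, x ∈ S ↔ (x ∉ O ∧ ∃ o ∈ O, s(o, x) ∈ ω)) →
        ω ∈ K → (ω ∈ F ↔ Ψ S ω ∈ F')) →
      (prodBernoulli p).real
          ({ω | ∀ x : Fin n, x ∈ S ↔ (x ∉ O ∧ ∃ o ∈ O, s(o, x) ∈ ω)} ∩ F) =
        c S * (prodBernoulli (q S)).real F' := by
    intro S F F' hFF'
    rw [hc, ← hlaw S F']
    exact sigmaRec_inter_congr p hKc fun ω hL hKω => hFF' ω hL hKω
  have hA : (prodBernoulli p).real (⋃ o ∈ O, ⋃ x ∈ A, openConn o x) =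
      ∑ S : Finset (Fin n), c S * (prodBernoulli (q S)).real (⋃ s ∈ S, ⋃ x ∈ A, openConn s x) := by
    rw [sigmaRec_partition p O]
    exact Finset.sum_congr rfl fun S _ => hfac S _ _ (hgeoA S)
  have hb : (prodBernoulli p).real (⋃ o ∈ O, openConn o b) =
      ∑ S : Finset (Fin n), c S * (prodBernoulli (q S)).real (⋃ s ∈ S, openConn s b) := by
    rw [sigmaRec_partition p O]
    exact Finset.sum_congr rfl fun S _ => hfac S _ _ (hgeob S)
  have hab : ∀ a ∈ A, (prodBernoulli p).real (openConn a b) =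
      ∑ S : Finset (Fin n), c S * (prodBernoulli (q S)).real (openConn a b) := by
    intro a ha
    rw [sigmaRec_partition p O]
    exact Finset.sum_congr rfl fun S _ => hfac S _ _ (hgeoD a ha S)
  have hone : ∑ S : Finset (Fin n), c S = 1 := by
    have h := sigmaRec_partition p O Set.univ
    simp only [Set.inter_univ, probReal_univ] at h
    rw [hc]
    exact h.symm
  have hcnn : ∀ S, 0 ≤ c S := fun S => measureReal_nonneg
  have hR : ∑ a ∈ A, Λ a * (1 - (prodBernoulli p).real (openConn a b)) =
      ∑ S : Finset (Fin n), c S * ∑ a ∈ A, Λ a * (1 - (prodBernoulli (q S)).real (openConn a b)) := by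
    have h1 : ∀ a ∈ A, Λ a * (1 - (prodBernoulli p).real (openConn a b)) =
        ∑ S : Finset (Fin n), c S * (Λ a * (1 - (prodBernoulli (q S)).real (openConn a b))) := by
      intro a ha
      rw [hab a ha]
      have h2 : ∑ S : Finset (Fin n), c S * (Λ a * (1 - (prodBernoulli (q S)).real (openConn a b))) =
          Λ a * (∑ S : Finset (Fin n), c S - ∑ S : Finset (Fin n), c S *
            (prodBernoulli (q S)).real (openConn a b)) := by
        rw [← Finset.sum_sub_distrib, Finset.mul_sum]
        exact Finset.sum_congr rfl fun S _ => by ring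
      rw [h2, hone]
    rw [Finset.sum_congr rfl h1, Finset.sum_comm]
    exact Finset.sum_congr rfl fun S _ => by rw [Finset.mul_sum]
  rw [hA, hb, hR, ← Finset.sum_sub_distrib]
  refine Finset.sum_le_sum fun S _ => ?_
  rw [← mul_sub]
  rcases eq_or_ne (c S) 0 with h0 | h0
  · rw [h0, zero_mul, zero_mul]
  refine mul_le_mul_of_nonneg_left ?_ (hcnn S)
  have hS := sigmaRec_posLayer w p O S hpO h0
  have hα : (prodBernoulli (q S)).real (⋃ s ∈ S, ⋃ x ∈ A, openConn s x) ≤ 1 := measureReal_le_one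
  have hβ : 0 ≤ (prodBernoulli (q S)).real (⋃ s ∈ S, openConn s b) := measureReal_nonneg
  have hsum0 : 0 ≤ ∑ a ∈ A, Λ a * (1 - (prodBernoulli (q S)).real (openConn a b)) :=
    Finset.sum_nonneg fun a ha => mul_nonneg (hΛ a ha) (sub_nonneg.2 measureReal_le_one)
  by_cases hSe : S = ∅
  · subst hSe
    have h00 : (prodBernoulli (q ∅)).real
        (⋃ s ∈ (∅ : Finset (Fin n)), ⋃ x ∈ A, openConn s x) = 0 := by simp
    linarith
  by_cases hbS : b ∈ S
  · have h1 : (prodBernoulli (q S)).real (⋃ s ∈ S, openConn s b) = 1 := by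
      have huniv : (⋃ s ∈ S, openConn s b : Set (BondConfig (Fin n))) = Set.univ :=
        Set.eq_univ_of_forall fun ω =>
          Set.mem_iUnion₂.2 ⟨b, hbS, (SimpleGraph.Reachable.refl b : ω ∈ openConn b b)⟩
      rw [huniv, probReal_univ]
    linarith
  by_cases hSA : (S ∩ A).Nonempty
  · -- the beaten relays carry mass ≥ 1, and each of them fails at least as often as the glued layer
    have h5 := hL5 S hS hSA hbS
    set β := (prodBernoulli (q S)).real (⋃ s ∈ S, openConn s b) with hβdef
    set L := A.filter (fun a => (prodBernoulli (q S)).real (openConn a b) ≤ β) with hLdef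
    have hLA : L ⊆ A := Finset.filter_subset _ _
    have hstep1 : (1 - β) * ∑ a ∈ L, Λ a ≤ ∑ a ∈ L, Λ a * (1 - (prodBernoulli (q S)).real (openConn a b)) := by
      rw [Finset.mul_sum]
      refine Finset.sum_le_sum fun a ha => ?_
      have hle : (prodBernoulli (q S)).real (openConn a b) ≤ β := (Finset.mem_filter.1 ha).2
      have hΛa : 0 ≤ Λ a := hΛ a (hLA ha)
      nlinarith
    have hstep2 : ∑ a ∈ L, Λ a * (1 - (prodBernoulli (q S)).real (openConn a b)) ≤
        ∑ a ∈ A, Λ a * (1 - (prodBernoulli (q S)).real (openConn a b)) :=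
      Finset.sum_le_sum_of_subset_of_nonneg hLA
        (fun a ha _ => mul_nonneg (hΛ a ha) (sub_nonneg.2 measureReal_le_one))
    have h1β : 0 ≤ 1 - β := sub_nonneg.2 measureReal_le_one
    have hstep0 : 1 - β ≤ (1 - β) * ∑ a ∈ L, Λ a := by nlinarith
    linarith
  · exact hdef S hS (Finset.nonempty_iff_ne_empty.2 hSe)
      (Finset.disjoint_iff_inter_eq_empty.2 (Finset.not_nonempty_iff_eq_empty.1 hSA)) hbS

/-! ### Block form and observer forms -/
/-- **Additive gluing with fractional witnesses (block form, any depth)**: for blocks `O ⊆ R` (`R` closed,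
disjoint from `A`) whose every swallowable superset `U` has lower sets of `Λ`-mass `≥ 1`,
`μ_{glue O}(O ↔ A) − μ_{glue O}(O ↔ b) ≤ Σ_{a∈A} Λ a (1 − μ_{glue O}(a ↔ b))`; induction on active non-relay
vertices outside the block. [cite: KozmaNitzan2024, Thm. 4 and Lemma 5 (pp. 12–14) — one layer, point mass] -/
theorem fracWitness_blockGluing (A : Finset (Fin n)) (Λ : Fin n → ℝ) (b : Fin n) (hbA : b ∈ A)
    (hΛ : ∀ a ∈ A, 0 ≤ Λ a) (R : Finset (Fin n)) (hRA : Disjoint R A) :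
    ∀ (m : ℕ) (w : Sym2 (Fin n) → unitInterval) (O : Finset (Fin n)), O ⊆ R →
      (∀ x ∈ R, ∀ y : Fin n, y ∉ R → y ∉ A → w s(x, y) = 0) →
      (∀ U : Finset (Fin n), O ⊆ U → U ⊆ R → ∀ v ∈ A, (∃ x ∈ U, w s(x, v) ≠ 0) →
        1 ≤ ∑ a ∈ A.filter (fun a =>
          (prodBernoulli (fun e : Sym2 (Fin n) => if (∃ x ∈ e, x ∈ U) then 0 else w e)).real
              (openConn a b) ≤
            (prodBernoulli (fun e : Sym2 (Fin n) => if (∃ x ∈ e, x ∈ U) then 0 else w e)).real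
              (openConn v b)), Λ a) →
      (Finset.univ.filter fun x : Fin n =>
          x ∉ A ∧ x ∉ O ∧ ∃ y : Fin n, w s(x, y) ≠ 0).card ≤ m →
      (prodBernoulli (fun e : Sym2 (Fin n) =>
          if (∀ x ∈ e, x ∈ O) ∧ ¬ e.IsDiag then 1 else w e)).real
          (⋃ o ∈ O, ⋃ x ∈ A, openConn o x) -
        (prodBernoulli (fun e : Sym2 (Fin n) =>
          if (∀ x ∈ e, x ∈ O) ∧ ¬ e.IsDiag then 1 else w e)).real
          (⋃ o ∈ O, openConn o b) ≤
        ∑ a ∈ A, Λ a * (1 - (prodBernoulli (fun e : Sym2 (Fin n) =>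
          if (∀ x ∈ e, x ∈ O) ∧ ¬ e.IsDiag then 1 else w e)).real (openConn a b)) := by
  intro m
  induction m with
  | zero =>
    intro w O hOR hclosed hdom hcard
    exact step w O hOR hclosed hdom (fun S hS hSne hSA _ => by
      exfalso
      obtain ⟨x, hx⟩ := hSne
      obtain ⟨hxO, o, ho, hw⟩ := hS x hx
      have hxA : x ∉ A := Finset.disjoint_left.1 hSA hx
      have hmem : x ∈ Finset.univ.filter fun x : Fin n =>
          x ∉ A ∧ x ∉ O ∧ ∃ y : Fin n, w s(x, y) ≠ 0 :=
        Finset.mem_filter.2 ⟨Finset.mem_univ _, hxA, hxO, o, by rwa [Sym2.eq_swap]⟩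
      have := Finset.card_pos.2 ⟨x, hmem⟩
      omega)
  | succ m ih =>
    intro w O hOR hclosed hdom hcard
    exact step w O hOR hclosed hdom (fun S hS hSne hSA _ => by
      have hSR : S ⊆ R := by
        intro x hx
        obtain ⟨hxO, o, ho, hw⟩ := hS x hx
        by_contra hxR
        exact hw (hclosed o (hOR ho) x hxR (Finset.disjoint_left.1 hSA hx))
      refine ih (fun e : Sym2 (Fin n) => if (∃ x ∈ e, x ∈ O) then 0 else w e) S hSR ?_ ?_ ?_
      · intro x hx y hyR hyA
        show (if (∃ z ∈ s(x, y), z ∈ O) then (0 : unitInterval) else w s(x, y)) = 0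
        rw [hclosed x hx y hyR hyA]
        split_ifs <;> rfl
      · intro U' hSU' hU'R v hv hadj
        have hkk : (fun e : Sym2 (Fin n) => if (∃ x ∈ e, x ∈ U') then (0 : unitInterval) else
            (if (∃ x ∈ e, x ∈ O) then 0 else w e)) =
            (fun e : Sym2 (Fin n) => if (∃ x ∈ e, x ∈ O ∪ U') then 0 else w e) := by
          funext e
          by_cases h1 : ∃ x ∈ e, x ∈ U'
          · obtain ⟨x, hx, hxU⟩ := h1
            rw [if_pos ⟨x, hx, hxU⟩, if_pos ⟨x, hx, Finset.mem_union_right O hxU⟩]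
          · rw [if_neg h1]
            by_cases h2 : ∃ x ∈ e, x ∈ O
            · obtain ⟨x, hx, hxO⟩ := h2
              rw [if_pos ⟨x, hx, hxO⟩, if_pos ⟨x, hx, Finset.mem_union_left U' hxO⟩]
            · rw [if_neg h2, if_neg]
              rintro ⟨x, hx, hxOU⟩
              rcases Finset.mem_union.1 hxOU with h | h
              · exact h2 ⟨x, hx, h⟩
              · exact h1 ⟨x, hx, h⟩
        rw [hkk]
        refine hdom (O ∪ U') Finset.subset_union_left (Finset.union_subset hOR hU'R) v hv ?_
        obtain ⟨x, hxU', hwx⟩ := hadj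
        have hO : ¬ (∃ z ∈ s(x, v), z ∈ O) := fun h => hwx (by
          show (if (∃ z ∈ s(x, v), z ∈ O) then (0 : unitInterval) else w s(x, v)) = 0
          rw [if_pos h])
        have hwx' : w s(x, v) ≠ 0 := by
          intro h0
          apply hwx
          show (if (∃ z ∈ s(x, v), z ∈ O) then (0 : unitInterval) else w s(x, v)) = 0
          rw [if_neg hO, h0]
        exact ⟨x, Finset.mem_union_right O hxU', hwx'⟩
      · have hsub : (Finset.univ.filter fun x : Fin n =>
              x ∉ A ∧ x ∉ S ∧ ∃ y : Fin n,
                (if (∃ z ∈ s(x, y), z ∈ O) then (0 : unitInterval) else w s(x, y)) ≠ 0) ⊂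
            (Finset.univ.filter fun x : Fin n => x ∉ A ∧ x ∉ O ∧ ∃ y : Fin n, w s(x, y) ≠ 0) := by
          rw [Finset.ssubset_iff_subset_ne]
          refine ⟨fun x hx => ?_, fun heq => ?_⟩
          · obtain ⟨-, hxA, hxS, y, hy⟩ := Finset.mem_filter.1 hx
            have hO : ¬ (∃ z ∈ s(x, y), z ∈ O) := fun h => hy (by rw [if_pos h])
            rw [if_neg hO] at hy
            exact Finset.mem_filter.2 ⟨Finset.mem_univ _, hxA,
              fun hxO => hO ⟨x, Sym2.mem_mk_left x y, hxO⟩, y, hy⟩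
          · obtain ⟨x, hx⟩ := hSne
            obtain ⟨hxO, o, ho, hw⟩ := hS x hx
            have hxA : x ∉ A := Finset.disjoint_left.1 hSA hx
            have hmem : x ∈ Finset.univ.filter fun x : Fin n =>
                x ∉ A ∧ x ∉ O ∧ ∃ y : Fin n, w s(x, y) ≠ 0 :=
              Finset.mem_filter.2 ⟨Finset.mem_univ _, hxA, hxO, o, by rwa [Sym2.eq_swap]⟩
            rw [← heq] at hmem
            exact (Finset.mem_filter.1 hmem).2.2.1 hx
        have hlt := Finset.card_lt_card hsub
        omega)
  where
  /-- One application of the fractional engine at the block `O`. -/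
  step (w : Sym2 (Fin n) → unitInterval) (O : Finset (Fin n)) (hOR : O ⊆ R)
      (hclosed : ∀ x ∈ R, ∀ y : Fin n, y ∉ R → y ∉ A → w s(x, y) = 0)
      (hdom : ∀ U : Finset (Fin n), O ⊆ U → U ⊆ R → ∀ v ∈ A, (∃ x ∈ U, w s(x, v) ≠ 0) →
        1 ≤ ∑ a ∈ A.filter (fun a =>
          (prodBernoulli (fun e : Sym2 (Fin n) => if (∃ x ∈ e, x ∈ U) then 0 else w e)).real
              (openConn a b) ≤
            (prodBernoulli (fun e : Sym2 (Fin n) => if (∃ x ∈ e, x ∈ U) then 0 else w e)).real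
              (openConn v b)), Λ a)
      (hSteiner : ∀ S : Finset (Fin n), (∀ x ∈ S, x ∉ O ∧ ∃ o ∈ O, w s(o, x) ≠ 0) →
        S.Nonempty → Disjoint S A → b ∉ S →
        (prodBernoulli (fun e : Sym2 (Fin n) =>
            if (∀ x ∈ e, x ∈ S) ∧ ¬ e.IsDiag then 1 else
              if (∃ x ∈ e, x ∈ O) then 0 else w e)).real (⋃ s ∈ S, ⋃ x ∈ A, openConn s x) -
          (prodBernoulli (fun e : Sym2 (Fin n) =>
            if (∀ x ∈ e, x ∈ S) ∧ ¬ e.IsDiag then 1 else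
              if (∃ x ∈ e, x ∈ O) then 0 else w e)).real (⋃ s ∈ S, openConn s b) ≤
          ∑ a ∈ A, Λ a * (1 - (prodBernoulli (fun e : Sym2 (Fin n) =>
            if (∀ x ∈ e, x ∈ S) ∧ ¬ e.IsDiag then 1 else
              if (∃ x ∈ e, x ∈ O) then 0 else w e)).real (openConn a b))) :
      (prodBernoulli (fun e : Sym2 (Fin n) =>
          if (∀ x ∈ e, x ∈ O) ∧ ¬ e.IsDiag then 1 else w e)).real
          (⋃ o ∈ O, ⋃ x ∈ A, openConn o x) -
        (prodBernoulli (fun e : Sym2 (Fin n) =>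
          if (∀ x ∈ e, x ∈ O) ∧ ¬ e.IsDiag then 1 else w e)).real
          (⋃ o ∈ O, openConn o b) ≤
        ∑ a ∈ A, Λ a * (1 - (prodBernoulli (fun e : Sym2 (Fin n) =>
          if (∀ x ∈ e, x ∈ O) ∧ ¬ e.IsDiag then 1 else w e)).real (openConn a b)) := by
    have hOA : Disjoint O A := Finset.disjoint_of_subset_left hOR hRA
    have hbO : b ∉ O := fun h => Finset.disjoint_left.1 hOA h hbA
    refine sigmaRec_engine_frac w
      (fun e : Sym2 (Fin n) => if (∀ x ∈ e, x ∈ O) ∧ ¬ e.IsDiag then 1 else w e)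
      (fun (S : Finset (Fin n)) (e : Sym2 (Fin n)) =>
        if (∀ x ∈ e, x ∈ S) ∧ ¬ e.IsDiag then 1 else if (∃ x ∈ e, x ∈ O) then 0 else w e)
      O A Λ b
      (fun (S : Finset (Fin n)) (ω : BondConfig (Fin n)) =>
        {e | e ∈ ω ∧ ∀ x ∈ e, x ∉ O} ∪ {e | (∀ x ∈ e, x ∈ S) ∧ ¬ e.IsDiag})
      {ω | ∀ o ∈ O, ∀ o' ∈ O, o ≠ o' → s(o, o') ∈ ω} hΛ ?_ ?_ ?_ ?_ ?_ (stub_sigmaLaw n w O) ?_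
      hSteiner
    · intro ω hω
      simp only [Set.mem_setOf_eq] at hω
      push Not at hω
      obtain ⟨o, ho, o', ho', hne, hnot⟩ := hω
      refine ⟨s(o, o'), ?_, hnot⟩
      show (if (∀ y ∈ s(o, o'), y ∈ O) ∧ ¬ (s(o, o')).IsDiag then (1 : unitInterval)
        else w s(o, o')) = 1
      rw [if_pos]
      refine ⟨fun y hy => ?_, fun hd => hne (Sym2.mk_isDiag_iff.1 hd)⟩
      rcases Sym2.mem_iff.1 hy with rfl | rfl <;> assumption
    · intro o x hx
      show (if (∀ y ∈ s(o, x), y ∈ O) ∧ ¬ (s(o, x)).IsDiag then (1 : unitInterval)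
        else w s(o, x)) = w s(o, x)
      rw [if_neg]
      rintro ⟨h, -⟩
      exact hx (h x (Sym2.mem_mk_right o x))
    · intro S ω hL hK
      exact (stub_sigmaGeometry n O S ω hL hK).1 A hOA
    · intro S ω hL hK
      have h := (stub_sigmaGeometry n O S ω hL hK).1 {b} (Finset.disjoint_singleton_right.2 hbO)
      simpa only [Finset.set_biUnion_singleton] using h
    · intro a ha S ω hL hK
      have haO : a ∉ O := fun h => Finset.disjoint_left.1 hOA h ha
      exact (stub_sigmaGeometry n O S ω hL hK).2 a b haO hbO
    · -- relay layer at `v`: the kill(O)-lower set of `v` has mass ≥ 1 and is beaten (KN Lemma 5)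
      intro S hS hSA hbS
      obtain ⟨v, hv⟩ := hSA
      rw [Finset.mem_inter] at hv
      obtain ⟨-, o, ho, hw⟩ := hS v hv.1
      have hmass := hdom O (Finset.Subset.refl O) hOR v hv.2 ⟨o, ho, hw⟩
      refine hmass.trans (Finset.sum_le_sum_of_subset_of_nonneg (fun a ha => ?_)
        (fun a ha _ => hΛ a (Finset.mem_filter.1 ha).1))
      obtain ⟨haA, hle⟩ := Finset.mem_filter.1 ha
      exact Finset.mem_filter.2 ⟨haA, stub_gluingLemma5 n
        (fun e : Sym2 (Fin n) => if (∃ x ∈ e, x ∈ O) then 0 else w e) S a v b hv.1 hbS hle⟩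

/-- **Near-one gluing with fractional witnesses (observer form, any depth).**  `o ∈ R`, `R` disjoint from
`A` and closed under positive pairs towards non-relays, `b ∈ A`, weights `Λ ≥ 0` on `A`, and for every
`o ∈ U ⊆ R` and every relay `v` receiving a positive pair from `U` the lower set
`{a ∈ A : P_{G−U}(a ↔ b) ≤ P_{G−U}(v ↔ b)}` has `Λ`-mass `≥ 1`.  Then
`P(o ↔ A) − P(o ↔ b) ≤ Σ_{a∈A} Λ a · (1 − P(a ↔ b))`.
[cite: KozmaNitzan2024, Thm. 4 (pp. 12–14) — the case `R = {o}`, `Λ` a point mass] -/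
theorem nearOneGluing_of_fracWitnesses (n : ℕ) (w : Sym2 (Fin n) → unitInterval)
    (A R : Finset (Fin n)) (Λ : Fin n → ℝ) (o b : Fin n) (hoR : o ∈ R) (hRA : Disjoint R A)
    (hbA : b ∈ A) (hΛ : ∀ a ∈ A, 0 ≤ Λ a)
    (hclosed : ∀ x ∈ R, ∀ y : Fin n, y ∉ R → y ∉ A → w s(x, y) = 0)
    (hdom : ∀ U : Finset (Fin n), o ∈ U → U ⊆ R → ∀ v ∈ A, (∃ x ∈ U, w s(x, v) ≠ 0) →
      1 ≤ ∑ a ∈ A.filter (fun a =>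
        (prodBernoulli (fun e : Sym2 (Fin n) => if (∃ x ∈ e, x ∈ U) then 0 else w e)).real
            (openConn a b) ≤
          (prodBernoulli (fun e : Sym2 (Fin n) => if (∃ x ∈ e, x ∈ U) then 0 else w e)).real
            (openConn v b)), Λ a) :
    (prodBernoulli w).real (⋃ a ∈ A, openConn o a) - (prodBernoulli w).real (openConn o b) ≤
      ∑ a ∈ A, Λ a * (1 - (prodBernoulli w).real (openConn a b)) := by
  have key := fracWitness_blockGluing A Λ b hbA hΛ R hRA n w {o} (Finset.singleton_subset_iff.2 hoR)
    hclosed (fun U hoU hUR v hv hadj => hdom U (Finset.singleton_subset_iff.1 hoU) hUR v hv hadj)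
    ((Finset.card_le_univ _).trans (Fintype.card_fin n).le)
  rw [goodStep24_glue_singleton, Finset.set_biUnion_singleton, Finset.set_biUnion_singleton] at key
  exact key

/-- **The rank corollary (k-uniform).**  `o ∈ R`, `R` disjoint from `A` and closed under positive pairs
towards non-relays, `b ∈ A`, `1 ≤ r`, and for every `o ∈ U ⊆ R` and every relay `v` receiving a positive pair
from `U` at least `r` relays `a ∈ A` have `P_{G−U}(a ↔ b) ≤ P_{G−U}(v ↔ b)` (the observer's region never grabs
only relays among the `r` weakest of the region-deleted graph).  Then
`P(o ↔ A) − P(o ↔ b) ≤ (1/r) · Σ_{a∈A} P(a ↮ b)`: additive gluing with the AVERAGE relay unreliability and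
constant `|A|/r`.  [cite: KozmaNitzan2024, Conj. 3 (p. 15) — context] -/
theorem nearOneGluing_of_rank (n : ℕ) (w : Sym2 (Fin n) → unitInterval) (A R : Finset (Fin n))
    (o b : Fin n) (r : ℝ) (hr : 1 ≤ r) (hoR : o ∈ R) (hRA : Disjoint R A) (hbA : b ∈ A)
    (hclosed : ∀ x ∈ R, ∀ y : Fin n, y ∉ R → y ∉ A → w s(x, y) = 0)
    (hrank : ∀ U : Finset (Fin n), o ∈ U → U ⊆ R → ∀ v ∈ A, (∃ x ∈ U, w s(x, v) ≠ 0) →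
      r ≤ ((A.filter (fun a =>
        (prodBernoulli (fun e : Sym2 (Fin n) => if (∃ x ∈ e, x ∈ U) then 0 else w e)).real
            (openConn a b) ≤
          (prodBernoulli (fun e : Sym2 (Fin n) => if (∃ x ∈ e, x ∈ U) then 0 else w e)).real
            (openConn v b))).card : ℝ)) :
    (prodBernoulli w).real (⋃ a ∈ A, openConn o a) - (prodBernoulli w).real (openConn o b) ≤
      (1 / r) * ∑ a ∈ A, (1 - (prodBernoulli w).real (openConn a b)) := by
  have hr0 : 0 < r := lt_of_lt_of_le one_pos hr
  have key := nearOneGluing_of_fracWitnesses n w A R (fun _ => 1 / r) o b hoR hRA hbA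
    (fun a _ => le_of_lt (one_div_pos.2 hr0)) hclosed (fun U hoU hUR v hv hadj => by
      rw [Finset.sum_const, nsmul_eq_mul]
      have h := hrank U hoU hUR v hv hadj
      rw [mul_one_div]
      exact (one_le_div hr0).2 h)
  rw [Finset.mul_sum]
  exact key

end

end Summit.CriticalPhenomena.PercolationContinuityZ3.Theorems
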